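import Literature.MathematicalPhysics.QuantumFieldTheory.Balaban1983to89.B5GpSettingTorus
import Literature.MathematicalPhysics.QuantumFieldTheory.Balaban1983to89.B2Lemma25Torus

/-!
# `Balaban1983to89.B5Eq133G0Torus` — B5's operator G₀ = (Δ + aQ*Q)⁻¹ of (1.132) ON THE TOWER PRESENTATION
# (the vector averaging Q_k of (1.18) on Bałaban's tori `Site P ·`, per direction), its existence, «G₀J = a⁻¹J for
# J constant», and THE EQUALITY (1.133) «G₀ = G′ + G′(a_kQ′*Q′ − aQ*Q)G₀» PROVED as an operator identity

statement-level skeleton of published theorems with citation tags; proofs where landed; nothing here is a claim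
about the Yang–Mills mass gap

Source (lit-balaban / pub-balaban cells): T. Bałaban, *Propagators and renormalization transformations for lattice
gauge theories. I*, Commun. Math. Phys. **95** (1984) 17–40 [`Balaban1984PropagatorsI`, "B5"], pp. 19–21 [PDF 3–5]
((1.8), (1.11), (1.18), (1.20), the display before (1.22)) and p. 39 [PDF 23] ((1.132)–(1.134)); held as
`paper:balaban1984-cmp95-propagators-rt-i` (journal page = PDF page + 16), pages 3–5 and 23 materialised and read
this session (`lit read … --pages 2-5`, `--pages 22-24`).  [2] of B5 = T. Bałaban, *Regularity and decay of lattice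
Green's functions*, Commun. Math. Phys. **89** (1983) 571–597 [`Balaban1983RegularityDecay`, "B4"].

## WHAT IS PRINTED (verbatim)

p. 19 [PDF 3], after (1.8): «where A(Γ) = Σ_{b⊂Γ} A_b for arbitrary contour Γ, and x(c) denotes a point in the block
B(c₊) obtained by translation of x by the bond c»; (1.11): «(QA)_c = Σ_{x∈B(c₋)} L^{−(d+1)}A([x, x(c)])».
p. 20 [PDF 4], (1.18): «(Q_kA)_b = Σ_{x∈B^k(b₋)} η^{d+1}A([x, x(b)]), b ⊂ T₁^{(k)} = ℤ^d ∩ T_η, η = L^{−k}, (1.18) and x(b)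
is a point in B^k(b₊) obtained from x by translation by b. If b = ⟨y, y + e_μ⟩, then x(b) = x + e_μ.»; after (1.20):
«or denoting (Q′_kλ)(y) = Σ_{x∈B^k(y)} η^dλ(x), we have Q_kA^λ = Q_kA − ∂Q′_kλ.»
p. 21 [PDF 5], before (1.22): «⟨∂A, ∂A⟩ = ½ Σ_{x∈T_η,μ,ν} η^d|F_{μν}(x)|² = Σ_{x,μ,ν} η^d|(∂_μA_ν)(x)|² − … where Δ is
η-lattice Laplace operator for scalar functions and ∂* is the divergence operator for vector functions, ∂*A = Σ_μ ∂*_μA_μ.»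
p. 39 [PDF 23]: «This proof, and also a proof of (1.115)–(1.117), makes use of the identity G = G₀ + G₀∂P∂*G, (1.132)
where G₀ = (Δ + aQ*Q)⁻¹. This operator is similar to G′, but with the different averaging operator. We will prove
(1.115)–(1.117), and in fact the whole Proposition 1.2, for the operator G₀. … Properties of the operator G₀ can be
easily reduced to the corresponding properties of the operator G′ by the equality
  G₀ = G′ + G′(a_kQ′*Q′ − aQ*Q)G₀. (1.133)
We only have to know some weak bounds for G₀, for example bounds in the L²-norm (1.89), or (1.114). This operator is
given by the formula G₀J = Δ⁻¹J − aΔ⁻¹Q*φ⁻¹QΔ⁻¹J (1.134) for J orthogonal to constant functions, and G₀J = a⁻¹J for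
J constant».

## THE DICTIONARY (print ↦ Lean), and why G₀ splits over the directions

The tori are those of the tree's scalar tower `B1RG242Torus` (`Setup.Params`/`Site`): B5's η-lattice T_η, η = L^{−k},
is the finest torus `Site P 0` (2L^{m+K} sites per direction) read with `n = L^k` fine steps per unit, the unit lattice
T₁^{(k)} is `Site P k`, `x ∈ B^k(y)` is `Site.proj k k x = y` (`B1RG242Torus` §1; |B^k(y)| = L^{kd}, `card_Bj`), for
Bałaban's levels `k ≤ m + K` (`lvl P k = k`).  B5's SCALAR block average «(Q′_kλ)(y) = Σ_{x∈B^k(y)} η^dλ(x)» is the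
tower's `Qk P k` (`B1RG242Torus.Qk_mulVec`: L^{−kd}Σ_{B^k(y)}), its adjoint Q′*_k is `Qks P k`, and G′ = G′_k =
(Δ + a_kQ′*_kQ′_k)⁻¹ on T_η is `B5Display136Torus.Grs P a m² k = (B4Ineq115Torus.Marg P a m² k)⁻¹`
(`Marg = hOp P 0 (ε/(L^kε)) ((L^kε)²m²) + a_k•(Qks*Qk)`, a_k = `B1.aSeq a L k` the sequence of [2] generated by a;
B5 is massless, m² = 0, the tree keeps [2]'s m² ≥ 0 as a parameter), exactly as in `B5GpSettingTorus`/`B5Prop12GpTorus`.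

THE VECTOR AVERAGE (1.18).  A vector field on T_η is `A : Fin P.d → Site P 0 → ℝ` (A_μ(x) = the value on the fine bond
⟨x, x + ηe_μ⟩, the `Loc` of `B5GpSettingTorus.gpSetting`).  For the unit bond b = ⟨y, y + e_μ⟩ the straight contour
[x, x(b)] = [x, x + e_μ] consists of the n = L^k fine bonds ⟨x + tηe_μ, x + (t+1)ηe_μ⟩, t = 0, …, n − 1, so
«A([x, x(b)]) = Σ_{b′⊂[x,x+e_μ]} A_{b′}» = Σ_{t<n} A_μ(x + tηe_μ) (`lineMat_mulVec`; x + tηe_μ = `shiftN P x μ t`), and (1.18)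
reads (Q_kA)_μ(y) = η^{d+1} Σ_{x∈B^k(y)} Σ_{t<n} A_μ(x + tηe_μ) — it involves THE COMPONENT A_μ ONLY.  Hence Q_k is the direct
sum over μ of the d scalar operators `Qv P k μ : Matrix (Site P k) (Site P 0) ℝ` (`Qv_mulVec` = the printed sum), its
L²(T_η)-adjoint Q*_k (weights η^d on T_η, 1 on T₁^{(k)}) is the direct sum of `QvT P k μ = η^{−d}·(Qv P k μ)ᵀ`
(`adjoint_Qv`, stated for the tower's scalar products of [B1] (1.5), which are B5's up to one common factor (L^kε)^d), and
since «Δ is η-lattice Laplace operator for scalar functions» acting on each component (p. 21), THE OPERATOR Δ + aQ*Q OF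
(1.132) IS THE DIRECT SUM OVER μ OF THE d SCALAR OPERATORS
  `M0 P a m² k μ := hOp P 0 (ε/(L^kε)) ((L^kε)²m²) + a • (QvT P k μ * Qv P k μ)`   (−Δ^η + (L^kε)²m² + aQ*_μQ_μ)
on `Site P 0 → ℝ`, and G₀ = ⊕_μ `G0 P a m² k μ`, `G0 := M0⁻¹`.  Likewise a_kQ′*Q′ − aQ*Q = ⊕_μ `V P a k μ`,
`V := a_k•(Qks P k * Qk P k) − a•(QvT P k μ * Qv P k μ)` (Q′*Q′ acts by the same scalar operator on every component),
and (1.133) is the conjunction over μ of the d identities `eq1133` below.  (B5's top level is k = K: L^Kε = 1, η = ε,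
`M0 P a m² P.K μ = B1RG242Torus.H P m² + a•(QvT*Qv)` (`M0_top`), G′_K = `(tower P a m²).G P.K` (`Grs_top`).)

## WHAT THIS MODULE PROVES (kernel-checked, zero sorry)

§1 `shiftN`, `lineMat`, `Qv`, `Qv_mulVec` ((1.18) verbatim), `Qv_const` (Q_k of a constant field is the same constant:
   |B^k(y)|·n·η^{d+1} = 1), `sum_Qv_mulVec` (Σ_y (Q_kA)_μ(y) = η^d Σ_x A_μ(x): the translations x ↦ x + tηe_μ are
   bijections of the torus), `Qv_colsum` (every fine bond lies on exactly n of the segments, counted with weight: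
   Σ_y Qv y x = η^d), `QvT`, `adjoint_Qv` (Q*_k IS the adjoint), `QvT_mulVec_const` (Q*_k1 = 1).
§2 `M0`, `M0_mulVec_const` ((Δ + aQ*Q)c = (a + (L^kε)²m²)c), THE KERNEL LEMMA `M0_ker` ((−Δ^η + (L^kε)²m² + aQ*_μQ_μ)φ = 0,
   a > 0, m² ≥ 0 ⟹ ∂φ = 0 and Q_μφ = 0 (`B1RG242.ker_add_smul_adj`) ⟹ φ constant (`const_of_hOp_ker`) ⟹ φ = Q_μφ = 0),
   `M0_isUnit` — G₀ EXISTS on every torus of the family, for every level k ≤ m + K —, `G0`, `M0_mul_G0`, `G0_mul_M0`,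
   `G0_mulVec_const` («G₀J = a⁻¹J for J constant», with a ↦ a + (L^kε)²m² for the tree's massive parameter),
   `M0_isSymm`/`G0_isSymm` (G₀ is symmetric: the matrices are symmetric and the weight η^d is uniform).
§3 `V`, `M0_eq_Marg_sub_V` (G₀⁻¹ = G′⁻¹ − (a_kQ′*Q′ − aQ*Q)), and **(1.133)** `eq1133 : G0 = Grs + Grs * V * G0` for a > 0,
   m² ≥ 0, 1 ≤ k ≤ m + K (the tree's `B5.resolvent_identity` with G′G′⁻¹ = 1 (`B4Ineq115Torus.Grs_mul_Marg`) and
   G₀⁻¹G₀ = 1), with its applied form `G0_mulVec_eq133` (G₀f = G′f + G′V G₀f) and the top-level readings `M0_top`, `Grs_top`.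

## HONEST SCOPE / WHAT IS NOT HERE

(i) U = 1 throughout (B5 Chapter 1's operators contain no gauge field; the tower is the tree's U = 1 tower).  (ii) Only
the tori of `Setup` (2L^m unit-lattice sites per direction at the top level), as in every `…Torus` module of the lineage.
(iii) (1.134)'s first clause (G₀ on the orthogonal complement of the constants via Δ⁻¹ and φ = (1.81)'s operator) and
«Proposition 1.1 for G₀» are NOT typed here — the latter is r02's `B5Prop11G0Torus` on the matrix presentation
`Tor (fine n M) × Fin d`, to be bridged to this presentation by the site bijection (r02, `B5SiteBridgeP12`); only the
constant clause «G₀J = a⁻¹J for J constant» is proved (`G0_mulVec_const`).  (iv) (1.132) (G = G₀ + G₀∂P∂*G, involving the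
projection P of (1.26)) is r02's matrix-side material (`B5Prop11G0Torus.G0inv_eq`) and is not restated.  (v) This module
is the operator-level input of the G₀-setting of record and of the `B5Transfer133.Carrier133`/`Display133` instance
(the USE of (1.133) entry by entry, B5.Prop1.2 census (vii)); those are separate files.
CELL BOOK-KEEPING (lit-balaban): rows B5.Eq1.134 ((1.132)–(1.134)) and B5.Prop1.2 census (vii) of ROWS-B5 (owner r02,
referee ref-4); VALUE = the located «equality (1.133)» becomes a theorem for Bałaban's actual operators on the torus
(existence of G₀ included), NOT summit progress.
-/

namespace Literature.MathematicalPhysics.QuantumFieldTheory.Balaban1983to89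

open Matrix

noncomputable section

namespace B5Eq133G0Torus

open B1RG242Torus B5Display136Torus B4Ineq115Torus B2Lemma25Torus

variable (P : Params)

/-! ## §1 The straight contours [x, x + e_μ] and the vector average Q_k of (1.18), per direction -/

/-- `x + t·ηe_μ` on the torus T^{(i)} (t fine steps in the direction μ). [folklore] -/
def shiftN {i : ℕ} (x : Site P i) (μ : Fin P.d) (t : ℕ) : Site P i := Function.update x μ (x μ + t)

variable {P} in
/-- Zero steps of the translation «x ↦ x(b) = x + e_μ» resolved into fine steps. [cite: Balaban1984PropagatorsI, (1.18) p.20 («x(b) … obtained from x by translation by b»)] -/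
theorem shiftN_zero {i : ℕ} (x : Site P i) (μ : Fin P.d) : shiftN P x μ 0 = x := by
  simp [shiftN]

variable {P} in
/-- One more fine step is one unit shift (`Site.shift`). [cite: Balaban1984PropagatorsI, (1.18) p.20 («x(b) … obtained from x by translation by b»)] -/
theorem shiftN_succ {i : ℕ} (x : Site P i) (μ : Fin P.d) (t : ℕ) :
    shiftN P x μ (t + 1) = Site.shift (shiftN P x μ t) μ := by
  simp only [shiftN, Site.shift, Function.update_idem, Function.update_self, Nat.cast_succ, add_assoc]

variable {P} in
/-- The translation `x ↦ x + tηe_μ` is injective (hence a bijection of the finite torus). [cite: Balaban1984PropagatorsI, (1.18) p.20 («x(b) … obtained from x by translation by b»)] -/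
theorem shiftN_injective {i : ℕ} (μ : Fin P.d) (t : ℕ) :
    Function.Injective fun x : Site P i => shiftN P x μ t := by
  intro x x' h
  funext ν
  have hν := congrFun h ν
  by_cases hμ : ν = μ
  · subst hμ
    simpa [shiftN] using hν
  · simpa [shiftN, Function.update_of_ne hμ] using hν

variable {P} in
/-- Sums over the torus are invariant under the translations `x ↦ x + tηe_μ`. [cite: Balaban1984PropagatorsI, (1.18) p.20 («x(b) … obtained from x by translation by b»)] -/
theorem sum_shiftN {i : ℕ} (μ : Fin P.d) (t : ℕ) (f : Site P i → ℝ) :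
    ∑ x, f (shiftN P x μ t) = ∑ x, f x :=
  Equiv.sum_comp (Equiv.ofBijective _ (Finite.injective_iff_bijective.mp (shiftN_injective μ t))) f

variable {P} in
/-- Powers of the shift matrix: `(shiftMat^t f)(x) = f(x + tηe_μ)` (the t-th point of the contour [x, x(b)]). [cite: Balaban1984PropagatorsI, (1.18) p.20 («x(b) … obtained from x by translation by b»)] -/
theorem shiftMat_pow_mulVec {i : ℕ} (μ : Fin P.d) (t : ℕ) (f : Site P i → ℝ) (x : Site P i) :
    (shiftMat P i μ ^ t *ᵥ f) x = f (shiftN P x μ t) := by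
  induction t generalizing f with
  | zero => rw [pow_zero, Matrix.one_mulVec, shiftN_zero]
  | succ t ih => rw [pow_succ, ← Matrix.mulVec_mulVec, ih, shiftMat_mulVec, shiftN_succ]

/-- «A([x, x(b)]) = Σ_{b′⊂[x, x+e_μ]} A_{b′}» as a matrix on scalar functions of the fine torus: summation over the lower
ends `x, x + ηe_μ, …, x + (n−1)ηe_μ` of the `n` fine bonds of the straight contour (`lineMat_mulVec`).
[cite: Balaban1984PropagatorsI, (1.8) p.19, (1.18) p.20] -/
def lineMat (n : ℕ) (μ : Fin P.d) : Matrix (Site P 0) (Site P 0) ℝ := ∑ t ∈ Finset.range n, shiftMat P 0 μ ^ t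

variable {P} in
/-- `(lineMat n μ f)(x) = Σ_{t<n} f(x + tηe_μ)`. [cite: Balaban1984PropagatorsI, (1.18) p.20] -/
theorem lineMat_mulVec (n : ℕ) (μ : Fin P.d) (f : Site P 0 → ℝ) (x : Site P 0) :
    (lineMat P n μ *ᵥ f) x = ∑ t ∈ Finset.range n, f (shiftN P x μ t) := by
  simp only [lineMat, Matrix.sum_mulVec, Finset.sum_apply, shiftMat_pow_mulVec]

/-- **B5's vector block average Q_k of (1.18), direction μ**: `(Q_kA)_μ(y) = η^{d+1} Σ_{x∈B^k(y)} Σ_{t<L^k} A_μ(x + tηe_μ)`,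
η = L^{−k}, as the matrix `η·(Q′_k ∘ lineMat)` from scalar functions on T_η (the component A_μ) to functions on T₁^{(k)}
(`Qv_mulVec`; realised exponent `lvl P k`, = k for k ≤ m + K). [cite: Balaban1984PropagatorsI, (1.18) p.20] -/
def Qv (k : ℕ) (μ : Fin P.d) : Matrix (Site P k) (Site P 0) ℝ :=
  ((P.L : ℝ) ^ lvl P k)⁻¹ • (Qk P k * lineMat P (P.L ^ lvl P k) μ)

variable {P}

/-- `Q′_k` verbatim at the tree's name `Qk P k` (`B1RG242Torus.Qk_mulVec`). [cite: Balaban1984PropagatorsI, (1.20) p.20] -/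
theorem Qk_mulVec' {k : ℕ} (hk : k ≤ P.m + P.K) (f : Site P 0 → ℝ) (y : Site P k) :
    (Qk P k *ᵥ f) y
      = (((P.L : ℝ) ^ P.d)⁻¹) ^ k * ∑ x ∈ Finset.univ.filter (fun x : Site P 0 => Site.proj k k x = y), f x :=
  Qk_mulVec 0 0 hk f y

/-- The normalisation of (1.18): `L^{−k}·L^{−kd} = η^{d+1}`. [folklore] -/
private theorem eta_pow_succ (k : ℕ) :
    ((P.L : ℝ) ^ k)⁻¹ * (((P.L : ℝ) ^ P.d)⁻¹) ^ k = (((P.L : ℝ) ^ k)⁻¹) ^ (P.d + 1) := by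
  rw [pow_succ', inv_pow, inv_pow, ← pow_mul, ← pow_mul, mul_comm P.d k]

/-- **(1.18) verbatim**: `(Q_kA)_μ(y) = η^{d+1} Σ_{x∈B^k(y)} Σ_{t<L^k} A_μ(x + tηe_μ)`, for Bałaban's levels k ≤ m + K.
[cite: Balaban1984PropagatorsI, (1.18) p.20] -/
theorem Qv_mulVec {k : ℕ} (hk : k ≤ P.m + P.K) (μ : Fin P.d) (f : Site P 0 → ℝ) (y : Site P k) :
    (Qv P k μ *ᵥ f) y = (((P.L : ℝ) ^ k)⁻¹) ^ (P.d + 1) *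
      ∑ x ∈ Finset.univ.filter (fun x : Site P 0 => Site.proj k k x = y),
        ∑ t ∈ Finset.range (P.L ^ k), f (shiftN P x μ t) := by
  rw [Qv, Matrix.smul_mulVec, ← Matrix.mulVec_mulVec, Pi.smul_apply, smul_eq_mul, Qk_mulVec' hk,
    lvl_of_le P hk, ← mul_assoc, eta_pow_succ]
  simp only [lineMat_mulVec]

/-- `L^k ≠ 0` in `ℝ`. [folklore] -/
private theorem Lpow_ne_zero (k : ℕ) : ((P.L : ℝ) ^ k) ≠ 0 := pow_ne_zero _ P.cast_L_pos.ne'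

/-- Q_k of a constant vector field is the same constant (|B^k(y)| = L^{kd} points, L^k bonds per contour, weight η^{d+1}).
[cite: Balaban1984PropagatorsI, (1.18) p.20] -/
theorem Qv_const {k : ℕ} (hk : k ≤ P.m + P.K) (μ : Fin P.d) (c : ℝ) :
    Qv P k μ *ᵥ (fun _ : Site P 0 => c) = fun _ => c := by
  funext y
  rw [Qv_mulVec hk]
  simp only [Finset.sum_const, Finset.card_range, nsmul_eq_mul, card_Bj hk y]
  push_cast
  have hL := Lpow_ne_zero (P := P) k
  have hLd := Lpow_ne_zero (P := P) (k * P.d)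
  rw [pow_succ, inv_pow, ← pow_mul]
  field_simp

/-- Σ_y (Q_kA)_μ(y) = η^d Σ_x A_μ(x): the blocks partition the torus and the translations x ↦ x + tηe_μ are bijections.
[cite: Balaban1984PropagatorsI, (1.18) p.20] -/
theorem sum_Qv_mulVec {k : ℕ} (hk : k ≤ P.m + P.K) (μ : Fin P.d) (f : Site P 0 → ℝ) :
    ∑ y, (Qv P k μ *ᵥ f) y = (((P.L : ℝ) ^ k)⁻¹) ^ P.d * ∑ x, f x := by
  simp_rw [Qv_mulVec hk]
  rw [← Finset.mul_sum, Finset.sum_fiberwise Finset.univ (fun x : Site P 0 => Site.proj k k x), Finset.sum_comm]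
  simp_rw [sum_shiftN]
  rw [Finset.sum_const, Finset.card_range, nsmul_eq_mul, Nat.cast_pow, pow_succ, mul_assoc,
    inv_mul_cancel_left₀ (Lpow_ne_zero (P := P) k)]

/-- Column sums of Q_k: every fine bond ⟨x, x + ηe_μ⟩ lies on exactly L^k of the contours [x′, x′ + e_μ], so
Σ_y Qv y x = L^k·η^{d+1} = η^d. [cite: Balaban1984PropagatorsI, (1.18) p.20] -/
theorem Qv_colsum {k : ℕ} (hk : k ≤ P.m + P.K) (μ : Fin P.d) (x : Site P 0) :
    ∑ y, Qv P k μ y x = (((P.L : ℝ) ^ k)⁻¹) ^ P.d := by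
  have h := sum_Qv_mulVec hk μ (fun x' => if x' = x then 1 else 0)
  have h1 : ∀ y, (Qv P k μ *ᵥ fun x' => if x' = x then (1 : ℝ) else 0) y = Qv P k μ y x := fun y => by
    simp only [Matrix.mulVec, dotProduct, mul_ite, mul_one, mul_zero, Finset.sum_ite_eq', Finset.mem_univ, if_true]
  simp_rw [h1] at h
  rw [h, Finset.sum_ite_eq', if_pos (Finset.mem_univ _), mul_one]

variable (P) in
/-- **Q*_k, direction μ**: the L²-adjoint of `Qv P k μ` for the weights η^d on T_η and 1 on T₁^{(k)}, i.e. `η^{−d}·Qvᵀ`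
(`adjoint_Qv`). [cite: Balaban1984PropagatorsI, (1.132) p.39 (the Q* of «G₀ = (Δ + aQ*Q)⁻¹»)] -/
def QvT (k : ℕ) (μ : Fin P.d) : Matrix (Site P 0) (Site P k) ℝ := (((P.L : ℝ) ^ P.d) ^ lvl P k) • (Qv P k μ)ᵀ

/-- `⟨φ, Q*ψ⟩ = η^{−d}⟨Q φ, ψ⟩` for the unweighted sums. [folklore] -/
private theorem dotProduct_QvT_mulVec (k : ℕ) (μ : Fin P.d) (φ : Site P 0 → ℝ) (ψ : Site P k → ℝ) :
    φ ⬝ᵥ (QvT P k μ *ᵥ ψ) = (((P.L : ℝ) ^ P.d) ^ lvl P k) * ((Qv P k μ *ᵥ φ) ⬝ᵥ ψ) := by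
  rw [QvT, Matrix.smul_mulVec, dotProduct_smul, smul_eq_mul, Matrix.mulVec_transpose, dotProduct_comm φ,
    ← Matrix.dotProduct_mulVec, dotProduct_comm ψ]

/-- **Q*_k IS THE ADJOINT OF Q_k** for the scalar products of [B1] (1.5) used by the tower — weight ε^d on T_ε (`WE P`) and
(L^kε)^d on T^{(k)} (`W P k`) —, which are B5's ⟨,⟩_{L²(T_η)} (weight η^d) and Σ_{T₁^{(k)}} (weight 1) times the common factor
(L^kε)^d. [cite: Balaban1984PropagatorsI, (1.132) p.39] -/
theorem adjoint_Qv (k : ℕ) (μ : Fin P.d) (φ : Site P 0 → ℝ) (ψ : Site P k → ℝ) :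
    φ ⬝ᵥ (WE P *ᵥ (QvT P k μ *ᵥ ψ)) = (Qv P k μ *ᵥ φ) ⬝ᵥ (W P k *ᵥ ψ) := by
  rw [WE, W, dotProduct_weight_mulVec, dotProduct_weight_mulVec, dotProduct_QvT_mulVec, ← mul_assoc]
  congr 1
  rw [Params.spacing, mul_pow, ← pow_mul, ← pow_mul, mul_comm P.d (lvl P k)]
  exact mul_comm _ _

/-- `Q*_k` of a constant is the same constant (`Q*_k1 = 1`: the column sums `η^d` times `η^{−d}`).
[cite: Balaban1984PropagatorsI, (1.134) p.39 («G₀J = a⁻¹J for J constant»)] -/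
theorem QvT_mulVec_const {k : ℕ} (hk : k ≤ P.m + P.K) (μ : Fin P.d) (c : ℝ) :
    QvT P k μ *ᵥ (fun _ : Site P k => c) = fun _ => c := by
  funext x
  rw [QvT, Matrix.smul_mulVec, Pi.smul_apply, smul_eq_mul, lvl_of_le P hk]
  simp only [Matrix.mulVec, dotProduct, Matrix.transpose_apply]
  rw [← Finset.sum_mul, Qv_colsum hk, ← mul_assoc, inv_pow, ← pow_mul, ← pow_mul, mul_comm k P.d,
    mul_inv_cancel₀ (Lpow_ne_zero (P := P) _), one_mul]

/-! ## §2 G₀ = (Δ + aQ*Q)⁻¹, direction μ: existence, constants, symmetry -/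

variable (P) in
/-- **G₀⁻¹ = Δ + aQ*Q restricted to the component μ** on the η = L^{−k} lattice, with [2]'s mass kept as a parameter:
`−Δ^η + (L^kε)²m² + a·Q*_μQ_μ` (B5: m² = 0; at k = K it is `H P m² + a•(QvT*Qv)`, `M0_top`).
[cite: Balaban1984PropagatorsI, (1.132) p.39] -/
def M0 (a msq : ℝ) (k : ℕ) (μ : Fin P.d) : Matrix (Site P 0) (Site P 0) ℝ :=
  hOp P 0 (P.eps / P.spacing k) (P.spacing k ^ 2 * msq) + a • (QvT P k μ * Qv P k μ)

/-- `(Δ + aQ*Q)c = (a + (L^kε)²m²)c` on constants (Δc = 0 on the torus, Q*Qc = c). [cite: Balaban1984PropagatorsI, (1.134) p.39] -/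
theorem M0_mulVec_const (a msq : ℝ) {k : ℕ} (hk : k ≤ P.m + P.K) (μ : Fin P.d) (c : ℝ) :
    M0 P a msq k μ *ᵥ (fun _ : Site P 0 => c) = fun _ => (P.spacing k ^ 2 * msq + a) * c := by
  rw [M0, Matrix.add_mulVec, Matrix.smul_mulVec, ← Matrix.mulVec_mulVec, Qv_const hk, QvT_mulVec_const hk,
    hOp_mulVec_const]
  funext x
  simp only [Pi.add_apply, Pi.smul_apply, smul_eq_mul]
  ring

/-- A harmonic function on the torus is constant: `(−Δ^s + m²)f = 0`, m² ≥ 0, s ≠ 0 ⟹ f(x) = f(x₀) (the first half of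
the kernel lemma `B1RG242Torus.eq_zero_of_ker`: the form gives ∂_μf = 0 for every μ) — B5 p. 22 on the torus Laplacian:
«Constant functions form the eigenspace corresponding to the eigenvalue 0». [cite: Balaban1984PropagatorsI, p.22 («Constant
functions form the eigenspace corresponding to the eigenvalue 0»)] -/
theorem const_of_hOp_ker {i : ℕ} {s msq : ℝ} (hs : s ≠ 0) (hm : 0 ≤ msq) (f : Site P i → ℝ)
    (hH : hOp P i s msq *ᵥ f = 0) (x : Site P i) : f x = f default := by
  have hform := form_hOp s msq f
  rw [hH, dotProduct_zero] at hform
  have h1 : 0 ≤ msq * (f ⬝ᵥ f) := mul_nonneg hm (Finset.sum_nonneg fun x _ => mul_self_nonneg (f x))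
  have h2 : ∀ μ, 0 ≤ (deriv P i s μ *ᵥ f) ⬝ᵥ (deriv P i s μ *ᵥ f) :=
    fun μ => Finset.sum_nonneg fun x _ => mul_self_nonneg _
  have hsum : ∑ μ, (deriv P i s μ *ᵥ f) ⬝ᵥ (deriv P i s μ *ᵥ f) = 0 := by
    have := Finset.sum_nonneg fun μ (_ : μ ∈ (Finset.univ : Finset (Fin P.d))) => h2 μ
    linarith
  have h3 : ∀ μ, (deriv P i s μ *ᵥ f) ⬝ᵥ (deriv P i s μ *ᵥ f) = 0 := fun μ =>
    (Finset.sum_eq_zero_iff_of_nonneg fun μ _ => h2 μ).mp hsum μ (Finset.mem_univ μ)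
  have hshift : ∀ μ x, f (Site.shift x μ) = f x := by
    intro μ x
    have hD : deriv P i s μ *ᵥ f = 0 := dotProduct_self_eq_zero.mp (h3 μ)
    have hx := congrFun hD x
    rw [deriv_mulVec, Pi.zero_apply, mul_eq_zero] at hx
    rcases hx with hx | hx
    · exact absurd hx (inv_ne_zero hs)
    · exact sub_eq_zero.mp hx
  exact Site.const_of_shift_invariant f hshift x default

/-- **THE KERNEL LEMMA FOR G₀⁻¹**: `(−Δ^η + (L^kε)²m² + aQ*_μQ_μ)φ = 0` with a > 0, m² ≥ 0 ⟹ φ = 0 (positivity of the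
two forms and adjointness give Δ-harmonicity and Q_μφ = 0; harmonic ⟹ constant; Q_μ of a constant is the constant).
[cite: Balaban1984PropagatorsI, (1.132) p.39] -/
theorem M0_ker {a msq : ℝ} (ha : 0 < a) (hm : 0 ≤ msq) {k : ℕ} (hk : k ≤ P.m + P.K) (μ : Fin P.d)
    (φ : Site P 0 → ℝ) (h0 : M0 P a msq k μ *ᵥ φ = 0) : φ = 0 := by
  have hs : P.eps / P.spacing k ≠ 0 := div_ne_zero P.eps_pos.ne' (P.spacing_pos k).ne'
  have hm' : 0 ≤ P.spacing k ^ 2 * msq := mul_nonneg (sq_nonneg _) hm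
  have h0' : (hOp P 0 (P.eps / P.spacing k) (P.spacing k ^ 2 * msq) + a • (QvT P k μ * Qv P k μ)) *ᵥ φ = 0 := h0
  obtain ⟨hH, hQ⟩ := B1RG242.ker_add_smul_adj (H := hOp P 0 (P.eps / P.spacing k) (P.spacing k ^ 2 * msq))
    (X := Qv P k μ) (Xs := QvT P k μ) (WE := WE P) (WK := W P k) ha
    (fun ψ => by
      rw [WE, dotProduct_weight_mulVec]
      exact mul_nonneg (pow_pos P.eps_pos _).le (form_hOp_nonneg _ hm' ψ))
    (fun u hu => weight_posDef (P.spacing_pos _) u hu) (fun ψ θ => adjoint_Qv k μ ψ θ) h0'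
  have hc : ∀ x, φ x = φ default := const_of_hOp_ker hs hm' φ hH
  have hφ : φ = fun _ => φ default := funext hc
  rw [hφ, Qv_const hk] at hQ
  have h00 : φ default = 0 := congrFun hQ default
  rw [hφ, h00]
  rfl

/-- **G₀ EXISTS**: `Δ + aQ*Q` (direction μ, level k ≤ m + K, a > 0, m² ≥ 0) is invertible on every torus of the family.
[cite: Balaban1984PropagatorsI, (1.132) p.39] -/
theorem M0_isUnit {a msq : ℝ} (ha : 0 < a) (hm : 0 ≤ msq) {k : ℕ} (hk : k ≤ P.m + P.K) (μ : Fin P.d) :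
    IsUnit (M0 P a msq k μ) := by
  rw [← Matrix.mulVec_injective_iff_isUnit]
  exact B1RG242.mulVec_injective_of_ker fun φ h0 => M0_ker ha hm hk μ φ h0

/-- `det (Δ + aQ*Q)` is a unit. [folklore] -/
private theorem M0_det_isUnit {a msq : ℝ} (ha : 0 < a) (hm : 0 ≤ msq) {k : ℕ} (hk : k ≤ P.m + P.K) (μ : Fin P.d) :
    IsUnit (M0 P a msq k μ).det :=
  (Matrix.isUnit_iff_isUnit_det _).mp (M0_isUnit ha hm hk μ)

variable (P) in
/-- **G₀ = (Δ + aQ*Q)⁻¹, direction μ** (level k, η = L^{−k}; mass parameter (L^kε)²m², = 0 in B5).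
[cite: Balaban1984PropagatorsI, (1.132) p.39] -/
def G0 (a msq : ℝ) (k : ℕ) (μ : Fin P.d) : Matrix (Site P 0) (Site P 0) ℝ := (M0 P a msq k μ)⁻¹

/-- `G₀⁻¹·G₀ = 1`. [cite: Balaban1984PropagatorsI, (1.132) p.39] -/
theorem M0_mul_G0 {a msq : ℝ} (ha : 0 < a) (hm : 0 ≤ msq) {k : ℕ} (hk : k ≤ P.m + P.K) (μ : Fin P.d) :
    M0 P a msq k μ * G0 P a msq k μ = 1 := by
  rw [G0, Matrix.mul_nonsing_inv _ (M0_det_isUnit ha hm hk μ)]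

/-- `G₀·G₀⁻¹ = 1`. [cite: Balaban1984PropagatorsI, (1.132) p.39] -/
theorem G0_mul_M0 {a msq : ℝ} (ha : 0 < a) (hm : 0 ≤ msq) {k : ℕ} (hk : k ≤ P.m + P.K) (μ : Fin P.d) :
    G0 P a msq k μ * M0 P a msq k μ = 1 := by
  rw [G0, Matrix.nonsing_inv_mul _ (M0_det_isUnit ha hm hk μ)]

/-- **«G₀J = a⁻¹J for J constant»** (with a ↦ a + (L^kε)²m² for the massive parameter; B5: m² = 0).
[cite: Balaban1984PropagatorsI, (1.134) p.39] -/
theorem G0_mulVec_const {a msq : ℝ} (ha : 0 < a) (hm : 0 ≤ msq) {k : ℕ} (hk : k ≤ P.m + P.K) (μ : Fin P.d) (c : ℝ) :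
    G0 P a msq k μ *ᵥ (fun _ : Site P 0 => c) = fun _ => (P.spacing k ^ 2 * msq + a)⁻¹ * c := by
  have hne : P.spacing k ^ 2 * msq + a ≠ 0 := (add_pos_of_nonneg_of_pos (mul_nonneg (sq_nonneg _) hm) ha).ne'
  have h : M0 P a msq k μ *ᵥ (fun _ : Site P 0 => (P.spacing k ^ 2 * msq + a)⁻¹ * c) = fun _ => c := by
    rw [M0_mulVec_const a msq hk μ]
    funext x
    field_simp
  rw [← h, Matrix.mulVec_mulVec, G0_mul_M0 ha hm hk μ, Matrix.one_mulVec]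

/-- `Q*_μQ_μ` is a symmetric matrix (`η^{−d}·QvᵀQv`). [folklore] -/
private theorem QvTQv_isSymm (k : ℕ) (μ : Fin P.d) : (QvT P k μ * Qv P k μ).IsSymm := by
  unfold Matrix.IsSymm
  rw [QvT, Matrix.smul_mul, Matrix.transpose_smul, Matrix.transpose_mul, Matrix.transpose_transpose]

/-- `Δ + aQ*Q` (direction μ) is a symmetric matrix; with the uniform weight η^d this is the symmetry of the operator on
L²(T_η). [cite: Balaban1984PropagatorsI, Prop. 1.1 p.33 («G is a symmetric operator»), (1.132) p.39] -/
theorem M0_isSymm (a msq : ℝ) (k : ℕ) (μ : Fin P.d) : (M0 P a msq k μ).IsSymm :=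
  (hOp_isSymm P 0 _ _).add ((QvTQv_isSymm k μ).smul _)

/-- **G₀ is symmetric**. [cite: Balaban1984PropagatorsI, Prop. 1.1 p.33, p.39 («we have Proposition 1.1 for G₀»)] -/
theorem G0_isSymm (a msq : ℝ) (k : ℕ) (μ : Fin P.d) : (G0 P a msq k μ).IsSymm := by
  show (G0 P a msq k μ)ᵀ = G0 P a msq k μ
  rw [G0, Matrix.transpose_nonsing_inv, (M0_isSymm a msq k μ).eq]

/-! ## §3 The equality (1.133) -/

variable (P) in
/-- **V = a_kQ′*_kQ′_k − aQ*_kQ_k restricted to the component μ** (Q′*Q′ acts by the same scalar operator on every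
component; a_k = [2]'s `B1.aSeq a L k`). [cite: Balaban1984PropagatorsI, (1.133) p.39] -/
def V (a : ℝ) (k : ℕ) (μ : Fin P.d) : Matrix (Site P 0) (Site P 0) ℝ :=
  B1.aSeq a P.L k • (Qks P k * Qk P k) - a • (QvT P k μ * Qv P k μ)

/-- `G₀⁻¹ = G′⁻¹ − V`: (Δ + aQ*Q) = (Δ + a_kQ′*Q′) − (a_kQ′*Q′ − aQ*Q), with the same mass term on both sides.
[cite: Balaban1984PropagatorsI, (1.133) p.39] -/
theorem M0_eq_Marg_sub_V (a msq : ℝ) (k : ℕ) (μ : Fin P.d) : M0 P a msq k μ = Marg P a msq k - V P a k μ := by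
  rw [M0, Marg, V]
  abel

/-- **THE EQUALITY (1.133)**, direction μ: `G₀ = G′ + G′(a_kQ′*Q′ − aQ*Q)G₀` for Bałaban's operators on the torus
(G′ = G′_k = `Grs P a m² k`, 1 ≤ k ≤ m + K, a > 0, m² ≥ 0) — the resolvent identity G′(G′⁻¹ − G₀⁻¹)G₀ = G₀ − G′.
[cite: Balaban1984PropagatorsI, (1.133) p.39] -/
theorem eq1133 {a msq : ℝ} (ha : 0 < a) (hm : 0 ≤ msq) {k : ℕ} (hk1 : 1 ≤ k) (hk : k ≤ P.m + P.K) (μ : Fin P.d) :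
    G0 P a msq k μ = Grs P a msq k + Grs P a msq k * V P a k μ * G0 P a msq k μ :=
  B5.resolvent_identity (G0 P a msq k μ) (Grs P a msq k) (M0 P a msq k μ) (Marg P a msq k) (V P a k μ)
    (Grs_mul_Marg ha hm hk1) (M0_mul_G0 ha hm hk μ) (M0_eq_Marg_sub_V a msq k μ)

/-- (1.133) applied to a source: `G₀f = G′f + G′(V(G₀f))`. [cite: Balaban1984PropagatorsI, (1.133) p.39] -/
theorem G0_mulVec_eq133 {a msq : ℝ} (ha : 0 < a) (hm : 0 ≤ msq) {k : ℕ} (hk1 : 1 ≤ k) (hk : k ≤ P.m + P.K)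
    (μ : Fin P.d) (f : Site P 0 → ℝ) :
    G0 P a msq k μ *ᵥ f = Grs P a msq k *ᵥ f + Grs P a msq k *ᵥ (V P a k μ *ᵥ (G0 P a msq k μ *ᵥ f)) := by
  conv_lhs => rw [eq1133 ha hm hk1 hk μ]
  rw [Matrix.add_mulVec, Matrix.mulVec_mulVec, Matrix.mulVec_mulVec]

/-- (1.133) for any operator composed on the left (∇G₀ = ∇G′ + ∇G′VG₀, ΔG₀ = ΔG′ + ΔG′VG₀, …): `D·G₀ = D·G′ + (D·G′)·V·G₀`.
[cite: Balaban1984PropagatorsI, (1.133) p.39] -/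
theorem mul_G0_eq133 {a msq : ℝ} (ha : 0 < a) (hm : 0 ≤ msq) {k : ℕ} (hk1 : 1 ≤ k) (hk : k ≤ P.m + P.K)
    (μ : Fin P.d) (D : Matrix (Site P 0) (Site P 0) ℝ) :
    D * G0 P a msq k μ = D * Grs P a msq k + D * Grs P a msq k * V P a k μ * G0 P a msq k μ := by
  conv_lhs => rw [eq1133 ha hm hk1 hk μ]
  simp only [Matrix.mul_add, Matrix.mul_assoc]

/-! ### B5's top level k = K (η = ε, L^Kε = 1) -/

/-- At the top level the argument of G₀ is the tower's `H P m² + a•Q*Q` (ε/(L^Kε) = ε, (L^Kε)²m² = m²).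
[cite: Balaban1984PropagatorsI, (1.132) p.39] -/
theorem M0_top (a msq : ℝ) (μ : Fin P.d) : M0 P a msq P.K μ = H P msq + a • (QvT P P.K μ * Qv P P.K μ) := by
  rw [M0, H, P.spacing_K, div_one, one_pow, one_mul]

/-- At the top level G′_K = G^ε_K of the tower ((L^Kε)² = 1; `B5Display136Torus.G_eq_smul_Grs`).
[cite: Balaban1984PropagatorsI, (1.135) p.39] -/
theorem Grs_top {a msq : ℝ} (ha : 0 < a) (hm : 0 ≤ msq) (hK : 1 ≤ P.K) :
    Grs P a msq P.K = (tower P a msq).G P.K := by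
  rw [G_eq_smul_Grs (P := P) ha hm hK, P.spacing_K, one_pow, one_smul]

/-- **(1.133) at B5's top level**, direction μ, with G′ the tower's G^ε_K: `G₀ = G_K + G_K·V·G₀`.
[cite: Balaban1984PropagatorsI, (1.133) p.39] -/
theorem eq1133_top {a msq : ℝ} (ha : 0 < a) (hm : 0 ≤ msq) (hK : 1 ≤ P.K) (μ : Fin P.d) :
    G0 P a msq P.K μ = (tower P a msq).G P.K + (tower P a msq).G P.K * V P a P.K μ * G0 P a msq P.K μ := by
  rw [← Grs_top ha hm hK]
  exact eq1133 ha hm hK (Nat.le_add_left P.K P.m) μ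

end B5Eq133G0Torus

end

end Literature.MathematicalPhysics.QuantumFieldTheory.Balaban1983to89
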